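import Mathlib
import HarnessLib
import Summits.HubbardSuperconductivity.HubbardSuperconductivity.Theorems.KLProgrammeKLRegimeVolumeLimitFlowFramesJets

/-!
# The COEFFICIENT WEIGHTS of the flow frames are `O_r(1)·|U|` FROM THE REV-2 TOWER: `coeffNorm r K_n^{(L,M)} ≤ Σ_{m<n} 4(2d_m+1)(1+4d_m)^r · cr|U|Λ_m²/e₀`,
# in particular `coeffNorm 0 K_n ≤ 1370·cr·|U|·e₀` uniformly in `n, L, M`

Cell gate-hubbard-kl, seat hubbard-kl-k3c5-p3 (g8).  Companion of `…VolumeLimitFlowFramesJets` (two volumes) at ONE volume.  The abstract frame class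
`FrameOK` does not control the plain coefficient weight `coeffNorm 0 K` (k3c4-p2's finding, `HubbardMatsubaraShellBandL1`: the degree of a flow frame is
`2·klFlowDeg n = 2⁸·4ⁿ`), and the engine's scale-`0` files key the degree-`2` pinned norm of the counter-quadratic to `(β/N)·coeffNorm 0 K`
(`…EngineScaleZeroNorms`, `HubbardMatsubaraShellNearIdentity`) or to a position-`ℓ¹` surrogate (`…EngineFramePosKernelBound`, `…ScaleZeroNormsL1`).
For the ACTUAL flow frames `K_n = −Σ_{m<n} 𝒥_{d_m}(E_μ(ν_m))` the weight IS controlled, by the readings' sups: the Jackson coefficients are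
`ĵ_k ĵ_l A(k,l)` with `|ĵ| ≤ 1/π` and `Σ_{k,l ≤ 2d}|A_h(k,l)| ≤ 4π²(2d+1)·sup|h|` (finite Bessel, k3c3-p1), the tube extension does not increase the sup,
and `RenormalisedAtF` bounds `sup_θ|ν_m(K_m)| ≤ cr|U|Λ_m²/e₀` at every scale of the tower.

* §1 `coeffNorm_jacksonFrame_le` (`coeffNorm r (𝒥_d F) ≤ 4(2d+1)(1+4d)^r·sup|F|`), `abs_klFrameExtFn_le_of_forall` (`|E_μ f| ≤ sup|f|`);
* §2 `coeffNorm_klFlowPieceJackson_le`, **`coeffNorm_klFlowFrameU_le_sum`** (data level: `C⁴` readings with `sup|ν_m| ≤ a_m` ⇒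
  `coeffNorm r K_n ≤ Σ_{m<n} 4(2d_m+1)(1+4d_m)^r a_m`);
* §3 **`coeffNorm_klFlowFrameU_le_of_towerV17F2`** (from `TowerP klPredsV17F2 …`: `a_m = R.cr·|U|·(klScale klE0 m)²/klE0`), the geometric sums
  `sum_four_klFlowDeg_weight_le` and the uniform corollary **`coeffNorm_zero_klFlowFrameU_le_of_towerV17F2`**: `coeffNorm 0 K_n^{(L,M)} ≤ 1370·R.cr·|U|·klE0`
  for every `n ≤ nScales β + 1`, `L ≥ Lstar`, `M ≥ Mstar L` (`Σ_m 4(2⁸4^m+1)·16^{−m} ≤ 4(2⁸·4/3 + 16/15) < 1370`);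
* §4 history level (r2d-p1's `hist`/`hC`/`hrates` binders of `…EngineTwoLegStepHistDoors`): `coeffNorm_fsub_klFlowFrameU_le_of_rates_hist`,
  `abs_iteratedDeriv_line_klFlowFrameU_sub_le_of_rates_hist` (the frame input of `hstep n`'s symbol-difference bracket), `coeffNorm_klFlowFrameU_le_of_hist`.

Everything is proved; no definition; nothing is asserted about the model.
-/

noncomputable section

namespace Summit.HubbardSuperconductivity.HubbardSuperconductivity.Theorems.TwoPointAssembly

set_option linter.dupNamespace false -- summit = problem name (single-conjunct summit), D-0017

open Real Finset Filter Topology MeasureTheory Literature.MathematicalPhysics.QuantumLattice Literature.Probability.LatticeModels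
open Literature.Analysis.Fourier.TrigApprox
open Summit.HubbardSuperconductivity.HubbardSuperconductivity.Theorems.DispersionFlow
open Summit.HubbardSuperconductivity.HubbardSuperconductivity.Theorems.KLRegimeSplit
open Summit.HubbardSuperconductivity.HubbardSuperconductivity.Theorems.KLProgrammeLegKernels

/-! ## §1 One Jackson frame: the coefficient weight is linear in `sup |F|` -/

section Jackson

variable {F : (Fin 2 → ℝ) → ℝ}

/-- **`coeffNorm r (𝒥_d F) ≤ 4(2d+1)(1+4d)^r·A`** for continuous `F` with `|F| ≤ A` everywhere (`|ĵ_k| ≤ 1/π`, finite Bessel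
`Σ_{k,l ≤ 2d}|A_F(k,l)| ≤ 4π²(2d+1)A`, `(1+k+l)^r ≤ (1+4d)^r` on the degree square). -/
theorem coeffNorm_jacksonFrame_le (d : ℕ) (hF : Continuous F) {A : ℝ} (hA : ∀ p, |F p| ≤ A) (r : ℕ) :
    (jacksonFrame d F).coeffNorm r ≤ 4 * (2 * d + 1) * (1 + 4 * d) ^ r * A := by
  have hA0 : 0 ≤ A := (abs_nonneg _).trans (hA 0)
  have hS := sum_abs_cosMoment_le hF hA (d + d)
  unfold TrigPolyC4v.coeffNorm
  have hdeg : (jacksonFrame d F).degree = d + d := rfl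
  rw [hdeg]
  have hterm : ∀ m ∈ range (d + d + 1), ∀ n ∈ range (d + d + 1),
      (1 + m + n : ℝ) ^ r * |(jacksonFrame d F).coeff m n| ≤ (1 + 4 * d : ℝ) ^ r * (1 / π ^ 2) * |cosMoment F m n| := by
    intro m hm n hn
    have hm' : m ≤ d + d := Nat.lt_succ_iff.mp (mem_range.mp hm)
    have hn' : n ≤ d + d := Nat.lt_succ_iff.mp (mem_range.mp hn)
    show (1 + m + n : ℝ) ^ r * |jkerCoeff d m * jkerCoeff d n * cosMoment F m n| ≤ _
    rw [abs_mul, abs_mul]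
    have h1 : (1 + m + n : ℝ) ^ r ≤ (1 + 4 * d : ℝ) ^ r := by
      apply pow_le_pow_left₀ (by positivity)
      have : (m : ℝ) ≤ d + d := by exact_mod_cast hm'
      have : (n : ℝ) ≤ d + d := by exact_mod_cast hn'
      linarith
    have h2 : |jkerCoeff d m| * |jkerCoeff d n| ≤ 1 / π * (1 / π) :=
      mul_le_mul (abs_jkerCoeff_le d hm') (abs_jkerCoeff_le d hn') (abs_nonneg _) (by positivity)
    calc (1 + m + n : ℝ) ^ r * (|jkerCoeff d m| * |jkerCoeff d n| * |cosMoment F m n|)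
        ≤ (1 + 4 * d : ℝ) ^ r * (1 / π * (1 / π) * |cosMoment F m n|) :=
          mul_le_mul h1 (mul_le_mul_of_nonneg_right h2 (abs_nonneg _)) (by positivity) (by positivity)
      _ = (1 + 4 * d : ℝ) ^ r * (1 / π ^ 2) * |cosMoment F m n| := by ring
  calc ∑ m ∈ range (d + d + 1), ∑ n ∈ range (d + d + 1), (1 + m + n : ℝ) ^ r * |(jacksonFrame d F).coeff m n|
      ≤ ∑ m ∈ range (d + d + 1), ∑ n ∈ range (d + d + 1), (1 + 4 * d : ℝ) ^ r * (1 / π ^ 2) * |cosMoment F m n| :=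
        sum_le_sum fun m hm => sum_le_sum fun n hn => hterm m hm n hn
    _ = (1 + 4 * d : ℝ) ^ r * (1 / π ^ 2) * ∑ κ ∈ range (d + d + 1) ×ˢ range (d + d + 1), |cosMoment F κ.1 κ.2| := by
        rw [sum_product, mul_sum]
        exact sum_congr rfl fun m _ => by rw [mul_sum]
    _ ≤ (1 + 4 * d : ℝ) ^ r * (1 / π ^ 2) * (4 * π ^ 2 * ((d + d : ℕ) + 1) * A) :=
        mul_le_mul_of_nonneg_left hS (by positivity)
    _ = 4 * (2 * d + 1) * (1 + 4 * d) ^ r * A := by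
        have hπ : π ≠ 0 := Real.pi_ne_zero
        field_simp
        push_cast
        ring

end Jackson

/-- **The tube extension does not increase the sup**: `|E_μ f p| ≤ A` whenever `|f| ≤ A` everywhere (`f` interval-integrable) — the case `g = 0` of
`abs_klFrameExtFn_sub_klFrameExtFn_le` (`E_μ 0 = 0`). -/
theorem abs_klFrameExtFn_le_of_forall (μ : ℝ) {f : ℝ → ℝ} (hf : IntervalIntegrable f volume 0 (2 * π)) {A : ℝ} (hA : ∀ θ, |f θ| ≤ A)
    (p : Fin 2 → ℝ) : |klFrameExtFn μ f p| ≤ A := by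
  have h := abs_klFrameExtFn_sub_klFrameExtFn_le μ hf (g := fun _ => (0 : ℝ)) intervalIntegrable_const (ε := A)
    (fun θ => by simpa using hA θ) p
  rwa [klFrameExtFn_zero, sub_zero] at h

/-! ## §2 Data level: sups of the readings ⇒ coefficient weights of the flow frames, every order -/

section Data

variable {L M : ℕ} [NeZero L] [NeZero M] {β U μ : ℝ}

/-- **One scale: `coeffNorm r (𝒥_{d_m}(E_μ(ν))) ≤ 4(2d_m+1)(1+4d_m)^r · sup_θ|ν|`** for a `C⁴` reading `ν` with `|ν| ≤ a` (`μ ∈ klWindowC`). -/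
theorem coeffNorm_klFlowPieceJackson_le (hμ : μ ∈ klWindowC) {K : TrigPolyC4v} (m : ℕ)
    (hc : ContDiff ℝ 4 (fun θ : ℝ => klLocalPart L M β U μ K m θ)) {a : ℝ} (ha : ∀ θ, |klLocalPart L M β U μ K m θ| ≤ a) (r : ℕ) :
    (klFlowPieceJackson L M β U μ m K).coeffNorm r ≤ 4 * (2 * klFlowDeg m + 1) * (1 + 4 * klFlowDeg m) ^ r * a := by
  have hK : (klFrameExtFn μ (fun θ : ℝ => klLocalPart L M β U μ K m θ)) =
      fun p : Fin 2 → ℝ => onM (klFrameExtFn μ (fun θ : ℝ => klLocalPart L M β U μ K m θ)) (WithLp.toLp 2 p) := by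
    funext p; simp [onM]
  have hcont : Continuous (klFrameExtFn μ (fun θ : ℝ => klLocalPart L M β U μ K m θ)) := by
    rw [hK]
    exact (contDiff_onM_klFrameExtFn hc (klLocalPart_periodic β U μ K m) hμ).continuous.comp (PiLp.continuous_toLp 2 _)
  exact coeffNorm_jacksonFrame_le (klFlowDeg m) hcont
    (fun p => abs_klFrameExtFn_le_of_forall μ (hc.continuous.intervalIntegrable _ _) ha p) r

/-- **DATA LEVEL: `coeffNorm r K_n^{(L,M)} ≤ Σ_{m<n} 4(2d_m+1)(1+4d_m)^r·a_m`** from `C⁴` readings at the scales `m < n` with `sup_θ|ν_m| ≤ a_m`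
(`K_n = −Σ_{m<n} piece_m` coefficient-wise, `coeffExt_klFlowFrameU`). -/
theorem coeffNorm_klFlowFrameU_le_sum (hμ : μ ∈ klWindowC) (n : ℕ)
    (hc : ∀ m < n, ContDiff ℝ 4 (fun θ : ℝ => klLocalPart L M β U μ (klFlowFrameU L M β U μ m) m θ))
    {a : ℕ → ℝ} (ha : ∀ m < n, ∀ θ : ℝ, |klLocalPart L M β U μ (klFlowFrameU L M β U μ m) m θ| ≤ a m) (r : ℕ) :
    (klFlowFrameU L M β U μ n).coeffNorm r ≤ ∑ m ∈ range n, 4 * (2 * klFlowDeg m + 1) * (1 + 4 * klFlowDeg m) ^ r * a m := by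
  have hpiece : ∀ m ∈ range n, (klFlowPiece L M β U μ m).coeffNorm r ≤ 4 * (2 * klFlowDeg m + 1) * (1 + 4 * klFlowDeg m) ^ r * a m := by
    intro m hm
    have hm' : m < n := mem_range.mp hm
    exact coeffNorm_klFlowPieceJackson_le hμ m (hc m hm') (ha m hm') r
  set A : TrigPolyC4v := klFlowFrameU L M β U μ n with hA
  set D : ℕ := A.degree + ∑ m ∈ range n, (klFlowDeg m + klFlowDeg m) with hD
  have hAD : A.degree ≤ D := Nat.le_add_right _ _
  have hPD : ∀ m ∈ range n, (klFlowPiece L M β U μ m).degree ≤ D := by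
    intro m hm
    rw [klFlowPiece_degree]
    exact (single_le_sum (f := fun m => klFlowDeg m + klFlowDeg m) (fun _ _ => Nat.zero_le _) hm).trans (Nat.le_add_left _ _)
  rw [coeffNorm_eq_sum_coeffExt A hAD r]
  calc ∑ m' ∈ range (D + 1), ∑ n' ∈ range (D + 1), (1 + m' + n' : ℝ) ^ r * |coeffExt A m' n'|
      ≤ ∑ m' ∈ range (D + 1), ∑ n' ∈ range (D + 1), ∑ m ∈ range n, (1 + m' + n' : ℝ) ^ r * |coeffExt (klFlowPiece L M β U μ m) m' n'| := by
        refine sum_le_sum fun m' _ => sum_le_sum fun n' _ => ?_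
        rw [hA, coeffExt_klFlowFrameU, abs_neg, ← mul_sum]
        exact mul_le_mul_of_nonneg_left (abs_sum_le_sum_abs _ _) (by positivity)
    _ = ∑ m' ∈ range (D + 1), ∑ m ∈ range n, ∑ n' ∈ range (D + 1), (1 + m' + n' : ℝ) ^ r * |coeffExt (klFlowPiece L M β U μ m) m' n'| :=
        sum_congr rfl fun m' _ => sum_comm
    _ = ∑ m ∈ range n, ∑ m' ∈ range (D + 1), ∑ n' ∈ range (D + 1), (1 + m' + n' : ℝ) ^ r * |coeffExt (klFlowPiece L M β U μ m) m' n'| :=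
        sum_comm
    _ = ∑ m ∈ range n, (klFlowPiece L M β U μ m).coeffNorm r :=
        sum_congr rfl fun m hm => (coeffNorm_eq_sum_coeffExt _ (hPD m hm) r).symm
    _ ≤ ∑ m ∈ range n, 4 * (2 * klFlowDeg m + 1) * (1 + 4 * klFlowDeg m) ^ r * a m := sum_le_sum hpiece

end Data

/-! ## §3 From the V17F2 tower: every order, and the uniform `r = 0` weight -/

section Tower

variable {G : GeoConsts} {P : SplitConsts} {Q : EngConsts} {R : RenConsts} {β U μ : ℝ} {K₀ : TrigPolyC4v} {Lstar : ℕ} {Mstar : ℕ → ℕ}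

/-- **EVERY ORDER, FROM THE TOWER: `coeffNorm r K_n^{(L,M)} ≤ Σ_{m<n} 4(2d_m+1)(1+4d_m)^r · (R.cr·|U|·Λ_m²/e₀)`** under
`TowerP klPredsV17F2 G P Q R β U μ K₀ Lstar Mstar` (`μ ∈ klWindowC`), for `Lstar ≤ L`, `Mstar L ≤ M`, `n ≤ nScales β + 1`: the renormalisation slot
`RenormFlowAtV17F m` gives `RenormalisedAtF … K_m R m` (`sup_θ|ν_m| ≤ R.cr·|U|·(klScale klE0 m)²/klE0`) and (E3a-F) gives `C⁴` readings, at every `m < n`. -/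
theorem coeffNorm_klFlowFrameU_le_of_towerV17F2 (hμ : μ ∈ klWindowC) (hT : TowerP klPredsV17F2 G P Q R β U μ K₀ Lstar Mstar)
    {L : ℕ} [NeZero L] (hL : Lstar ≤ L) {M : ℕ} [NeZero M] (hM : Mstar L ≤ M) {n : ℕ} (hn : n ≤ nScales β + 1) (r : ℕ) :
    (klFlowFrameU L M β U μ n).coeffNorm r ≤
      ∑ m ∈ range n, 4 * (2 * klFlowDeg m + 1) * (1 + 4 * klFlowDeg m) ^ r * (R.cr * |U| * klScale klE0 m ^ 2 / klE0) := by
  have hTL := hT L M hL hM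
  have key : ∀ m < n, ContDiff ℝ 4 (fun θ : ℝ => klLocalPart L M β U μ (klFlowFrameU L M β U μ m) m θ) ∧
      ∀ θ : ℝ, |klLocalPart L M β U μ (klFlowFrameU L M β U μ m) m θ| ≤ R.cr * |U| * klScale klE0 m ^ 2 / klE0 := by
    intro m hm
    have hm' : m ≤ nScales β := by omega
    obtain ⟨hren, -, -, htwo⟩ := hTL.1 m hm'
    have hren' : RenormFlowAtV17F L M β U μ R m := hren
    have htwo' : TwoLegStepV17F2 L M G P Q R β U μ m := htwo
    exact ⟨htwo'.1.1, hren'.1⟩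
  exact coeffNorm_klFlowFrameU_le_sum hμ n (fun m hm => (key m hm).1) (fun m hm => (key m hm).2) r

/-- The `r = 0` weight of one scale: `4(2d_m+1)·Λ_m²/e₀ = 4(2⁸·4^m + 1)·e₀·16^{−m} = 4e₀(2⁸·4^{−m} + 16^{−m})`. -/
theorem four_klFlowDeg_mul_klScale_sq (m : ℕ) :
    4 * (2 * (klFlowDeg m : ℝ) + 1) * (klScale klE0 m ^ 2 / klE0) = 4 * klE0 * (2 ^ 8 * ((4 : ℝ)⁻¹) ^ m + ((16 : ℝ)⁻¹) ^ m) := by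
  have he : (klE0 : ℝ) ≠ 0 := by norm_num [klE0]
  have h4 : ((4 : ℝ)) ^ m ≠ 0 := pow_ne_zero _ (by norm_num)
  simp only [klFlowDeg, klScale, Nat.cast_mul, Nat.cast_pow, Nat.cast_ofNat, inv_pow]
  have h16 : ((16 : ℝ)) ^ m = (4 : ℝ) ^ m * (4 : ℝ) ^ m := by rw [← mul_pow]; norm_num
  rw [h16]
  field_simp

/-- **The geometric sums**: `Σ_{m<n} 4(2d_m+1)·Λ_m²/e₀ ≤ 1370·e₀` (`Σ 4^{−m} ≤ 4/3`, `Σ 16^{−m} ≤ 16/15`, `4·(2⁸·4/3 + 16/15) < 1370`). -/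
theorem sum_four_klFlowDeg_weight_le (n : ℕ) :
    ∑ m ∈ range n, 4 * (2 * (klFlowDeg m : ℝ) + 1) * (klScale klE0 m ^ 2 / klE0) ≤ 1370 * klE0 := by
  have he0 : (0 : ℝ) < klE0 := by norm_num [klE0]
  simp_rw [four_klFlowDeg_mul_klScale_sq]
  rw [← mul_sum, sum_add_distrib, ← mul_sum]
  have hg4 : ∑ m ∈ range n, ((4 : ℝ)⁻¹) ^ m ≤ 4 / 3 := by
    have h := geom_sum_Ico_le_of_lt_one (m := 0) (n := n) (by norm_num : (0 : ℝ) ≤ 4⁻¹) (by norm_num : (4 : ℝ)⁻¹ < 1)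
    rw [range_eq_Ico]
    refine h.trans ?_
    norm_num
  have hg16 : ∑ m ∈ range n, ((16 : ℝ)⁻¹) ^ m ≤ 16 / 15 := by
    have h := geom_sum_Ico_le_of_lt_one (m := 0) (n := n) (by norm_num : (0 : ℝ) ≤ 16⁻¹) (by norm_num : (16 : ℝ)⁻¹ < 1)
    rw [range_eq_Ico]
    refine h.trans ?_
    norm_num
  nlinarith

/-- **THE PLAIN COEFFICIENT WEIGHT OF EVERY FLOW FRAME IS `O(U)`, FROM THE TOWER**: `coeffNorm 0 K_n^{(L,M)} ≤ 1370·R.cr·|U|·klE0` (`klE0 = 1/32`) for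
`Lstar ≤ L`, `Mstar L ≤ M`, `n ≤ nScales β + 1` — uniformly in `n, L, M, β` (requires `0 ≤ R.cr`, e.g. from `R.WF`). -/
theorem coeffNorm_zero_klFlowFrameU_le_of_towerV17F2 (hμ : μ ∈ klWindowC) (hT : TowerP klPredsV17F2 G P Q R β U μ K₀ Lstar Mstar) (hcr : 0 ≤ R.cr)
    {L : ℕ} [NeZero L] (hL : Lstar ≤ L) {M : ℕ} [NeZero M] (hM : Mstar L ≤ M) {n : ℕ} (hn : n ≤ nScales β + 1) :
    (klFlowFrameU L M β U μ n).coeffNorm 0 ≤ 1370 * R.cr * |U| * klE0 := by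
  refine (coeffNorm_klFlowFrameU_le_of_towerV17F2 hμ hT hL hM hn 0).trans ?_
  have hrw : ∀ m : ℕ, 4 * (2 * (klFlowDeg m : ℝ) + 1) * (1 + 4 * (klFlowDeg m : ℝ)) ^ 0 * (R.cr * |U| * klScale klE0 m ^ 2 / klE0) =
      (R.cr * |U|) * (4 * (2 * (klFlowDeg m : ℝ) + 1) * (klScale klE0 m ^ 2 / klE0)) := fun m => by ring
  simp_rw [hrw]
  rw [← mul_sum]
  calc R.cr * |U| * ∑ m ∈ range n, 4 * (2 * (klFlowDeg m : ℝ) + 1) * (klScale klE0 m ^ 2 / klE0)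
      ≤ R.cr * |U| * (1370 * klE0) := mul_le_mul_of_nonneg_left (sum_four_klFlowDeg_weight_le n) (by positivity)
    _ = 1370 * R.cr * |U| * klE0 := by ring

/-- **The sup of every flow frame from the coefficient weight**: `|K_n^{(L,M)}(p)| ≤ 1370·R.cr·|U|·klE0` (`abs_eval_le_coeffNorm`). -/
theorem abs_eval_klFlowFrameU_le_coeff_of_towerV17F2 (hμ : μ ∈ klWindowC) (hT : TowerP klPredsV17F2 G P Q R β U μ K₀ Lstar Mstar) (hcr : 0 ≤ R.cr)
    {L : ℕ} [NeZero L] (hL : Lstar ≤ L) {M : ℕ} [NeZero M] (hM : Mstar L ≤ M) {n : ℕ} (hn : n ≤ nScales β + 1) (p : Fin 2 → ℝ) :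
    |(klFlowFrameU L M β U μ n).eval p| ≤ 1370 * R.cr * |U| * klE0 :=
  ((klFlowFrameU L M β U μ n).abs_eval_le_coeffNorm p).trans (coeffNorm_zero_klFlowFrameU_le_of_towerV17F2 hμ hT hcr hL hM hn)

end Tower

/-! ## §4 History level (arbitrary comparison history `hist`, the binder shape of r2d-p1's `…EngineTwoLegStepHistDoors`): every order -/

section Hist

variable {hist : (L' M' : ℕ) → [NeZero L'] → [NeZero M'] → ℕ → Prop} {β U μ : ℝ}

/-- **Frame comparability at scale `n` IN EVERY DERIVATIVE from the rates below `n`** (the `coeffNorm` twin of r2d-p1's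
`abs_eval_klFlowFrameU_sub_le_of_rates_hist`): readings `C⁴` through `hC`, rates `a_m/L₁` at the scales `m < n` ⇒
`coeffNorm r (K_n^{(L₁,M₁)} ⊖ K_n^{(L₂,M₂)}) ≤ (Σ_{m<n} 4(2d_m+1)(1+4d_m)^r a_m)/L₁` — the frame input of the symbol-difference bracket of the one-scale
two-volume comparison `hstep n` ((E3f-F) STEP(n)). -/
theorem coeffNorm_fsub_klFlowFrameU_le_of_rates_hist {L₁ M₁ L₂ M₂ : ℕ} [NeZero L₁] [NeZero M₁] [NeZero L₂] [NeZero M₂] (hμ : μ ∈ klWindowC)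
    (hC : ∀ (L' M' : ℕ) [NeZero L'] [NeZero M'] (j : ℕ), hist L' M' j →
      ContDiff ℝ 4 (fun θ : ℝ => klLocalPart L' M' β U μ (klFlowFrameU L' M' β U μ j) j θ))
    {n : ℕ} {a : ℕ → ℝ} (h₁ : ∀ j < n, hist L₁ M₁ j) (h₂ : ∀ j < n, hist L₂ M₂ j)
    (hrates : ∀ m < n, ∀ θ : ℝ, |klLocalPart L₁ M₁ β U μ (klFlowFrameU L₁ M₁ β U μ m) m θ -
      klLocalPart L₂ M₂ β U μ (klFlowFrameU L₂ M₂ β U μ m) m θ| ≤ a m / L₁) (r : ℕ) :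
    (fsub (klFlowFrameU L₁ M₁ β U μ n) (klFlowFrameU L₂ M₂ β U μ n)).coeffNorm r ≤
      (∑ m ∈ range n, 4 * (2 * klFlowDeg m + 1) * (1 + 4 * klFlowDeg m) ^ r * a m) / L₁ := by
  refine (coeffNorm_fsub_klFlowFrameU_le_sum hμ n (fun m hm => hC L₁ M₁ m (h₁ m hm)) (fun m hm => hC L₂ M₂ m (h₂ m hm))
    (δ := fun m => a m / L₁) hrates r).trans (le_of_eq ?_)
  rw [sum_div]
  exact sum_congr rfl fun m _ => by ring

/-- **The lattice-line jets of the frame difference at scale `n` from the rates below `n`**: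
`|∂ₜᵏ (K_n^{(L₁,M₁)} − K_n^{(L₂,M₂)})(p + t e_l)| ≤ (Σ_{m<n} 4(2d_m+1)(1+4d_m)^k a_m)/L₁`. -/
theorem abs_iteratedDeriv_line_klFlowFrameU_sub_le_of_rates_hist {L₁ M₁ L₂ M₂ : ℕ} [NeZero L₁] [NeZero M₁] [NeZero L₂] [NeZero M₂]
    (hμ : μ ∈ klWindowC)
    (hC : ∀ (L' M' : ℕ) [NeZero L'] [NeZero M'] (j : ℕ), hist L' M' j →
      ContDiff ℝ 4 (fun θ : ℝ => klLocalPart L' M' β U μ (klFlowFrameU L' M' β U μ j) j θ))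
    {n : ℕ} {a : ℕ → ℝ} (h₁ : ∀ j < n, hist L₁ M₁ j) (h₂ : ∀ j < n, hist L₂ M₂ j)
    (hrates : ∀ m < n, ∀ θ : ℝ, |klLocalPart L₁ M₁ β U μ (klFlowFrameU L₁ M₁ β U μ m) m θ -
      klLocalPart L₂ M₂ β U μ (klFlowFrameU L₂ M₂ β U μ m) m θ| ≤ a m / L₁) (p : Fin 2 → ℝ) (l : Fin 2) (k : ℕ) (t : ℝ) :
    |iteratedDeriv k (fun t : ℝ => (klFlowFrameU L₁ M₁ β U μ n).eval (p + t • Pi.single l 1) -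
        (klFlowFrameU L₂ M₂ β U μ n).eval (p + t • Pi.single l 1)) t| ≤
      (∑ m ∈ range n, 4 * (2 * klFlowDeg m + 1) * (1 + 4 * klFlowDeg m) ^ k * a m) / L₁ := by
  rw [← Real.norm_eq_abs]
  exact (norm_iteratedDeriv_eval_sub_line_le_coeffNorm _ _ p l k t).trans
    (coeffNorm_fsub_klFlowFrameU_le_of_rates_hist hμ hC h₁ h₂ hrates k)

/-- **One volume, history level: `coeffNorm r K_n^{(L,M)} ≤ Σ_{m<n} 4(2d_m+1)(1+4d_m)^r a_m`** from `hist` below `n`, readings `C⁴` through `hC` and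
sup-bounded through `hA` (`|ν_m| ≤ a_m`, e.g. `RenormalisedAtF`). -/
theorem coeffNorm_klFlowFrameU_le_of_hist {L M : ℕ} [NeZero L] [NeZero M] (hμ : μ ∈ klWindowC)
    (hC : ∀ (L' M' : ℕ) [NeZero L'] [NeZero M'] (j : ℕ), hist L' M' j →
      ContDiff ℝ 4 (fun θ : ℝ => klLocalPart L' M' β U μ (klFlowFrameU L' M' β U μ j) j θ))
    {a : ℕ → ℝ} (hA : ∀ (L' M' : ℕ) [NeZero L'] [NeZero M'] (j : ℕ), hist L' M' j →
      ∀ θ : ℝ, |klLocalPart L' M' β U μ (klFlowFrameU L' M' β U μ j) j θ| ≤ a j)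
    {n : ℕ} (h : ∀ j < n, hist L M j) (r : ℕ) :
    (klFlowFrameU L M β U μ n).coeffNorm r ≤ ∑ m ∈ range n, 4 * (2 * klFlowDeg m + 1) * (1 + 4 * klFlowDeg m) ^ r * a m :=
  coeffNorm_klFlowFrameU_le_sum hμ n (fun m hm => hC L M m (h m hm)) (fun m hm => hA L M m (h m hm)) r

end Hist

end Summit.HubbardSuperconductivity.HubbardSuperconductivity.Theorems.TwoPointAssembly

end
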